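import Summits.Ventures.HodgeRepro2.T5PoincareDensity

/-!
# T5PoincareInvariance — the Poincaré MEASURE of the unit disc is `SU(1,1)`-invariant,
kernel-checked

Support for `route/T5-N4-p5.md` (sub-step N4.3 = (R3)), steps (N4.3.P1)/(N4.3.P2′)/(N4.3.P3):
the convergence integrals there are taken against the Haar measure of `H_j¹ = SU(1,1)` in Cartan
coordinates (Rühl's `½ sinh η dη (4π)⁻² dψ₁ dψ₂`, R3.10).  `T5PoincareDensity.density_invariance`
is the POINTWISE Jacobian identity for the Poincaré density `(1 − ‖z‖²)⁻²` under the Möbius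
action of `g ∈ SU(1,1)`; this file turns it into the MEASURE statement, through Mathlib's
change-of-variables theorem `integral_image_eq_integral_abs_det_fderiv_smul` on `ℂ ≅ ℝ²`:

* `det_restrictScalars_toSpanSingleton`: the real Jacobian determinant of a holomorphic map
  is `‖f′(z)‖²` — `det (w ↦ c·w : ℂ →L[ℝ] ℂ) = normSq c`
  (`LinearMap.det_restrictScalars` + `Algebra.norm_complex_apply`);
* `mobius_inv`, `mobius_image_ball`, `mobius_injOn_ball`: `g⁻¹ = !![ā, −b; −b̄, a]`, `g · 𝔻 = 𝔻`,
  and `g` is injective on `𝔻`;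
* `integral_ball_comp_mobius`: for every `g ∈ SU(1,1)` and every `F : ℂ → E`,
  `∫_{𝔻} (1 − ‖z‖²)⁻² • F (g·z) dA(z) = ∫_{𝔻} (1 − ‖z‖²)⁻² • F z dA(z)` — no integrability
  hypothesis — i.e. the Poincaré measure `dA/(1 − ‖z‖²)²` on `𝔻 = SU(1,1)/SO(2)` is
  `SU(1,1)`-invariant.  Together with `T5CartanCoordinates.integral_ball_eq_integral_cartan`
  (the same measure has density `sinh t cosh t = ½ sinh 2t` in the Cartan coordinate) this is the
  kernel form of «Rühl's measure is the invariant measure of `G/K` in Cartan coordinates».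

Honest scope: the measure on `G/K` only; Haar measure on `G = SU(1,1)` itself and the uniqueness
of invariant measures on `G/K` are NOT formalised.
-/

noncomputable section

namespace Summit.Ventures.HodgeRepro2.T5PoincareInvariance

open Complex MeasureTheory Set
open scoped ComplexConjugate
open Summit.Ventures.HodgeRepro2.T5PoincareDensity

variable {E : Type*} [NormedAddCommGroup E] [NormedSpace ℝ E]

/-- The real Jacobian determinant of multiplication by `c` on `ℂ` is `normSq c = ‖c‖²`. -/
theorem det_restrictScalars_toSpanSingleton (c : ℂ) :
    ((ContinuousLinearMap.toSpanSingleton ℂ c).restrictScalars ℝ).det = normSq c := by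
  simp only [ContinuousLinearMap.det, ContinuousLinearMap.coe_restrictScalars,
    LinearMap.det_restrictScalars, Algebra.norm_complex_apply, LinearMap.det_ring,
    ContinuousLinearMap.coe_coe, ContinuousLinearMap.toSpanSingleton_apply, one_smul]

/-- `z ∈ 𝔻 ↔ normSq z < 1`. -/
theorem mem_ball_iff_normSq (z : ℂ) : z ∈ Metric.ball (0 : ℂ) 1 ↔ normSq z < 1 := by
  rw [Metric.mem_ball, dist_zero_right, Complex.normSq_eq_norm_sq]
  constructor
  · intro h; nlinarith [norm_nonneg z]
  · intro h; nlinarith [norm_nonneg z]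

/-- `1 · z = z`. -/
theorem mobius_one (z : ℂ) : mobius (1 : Matrix (Fin 2) (Fin 2) ℂ) z = z := by
  simp [mobius]

/-- The inverse of `!![a, b; conj b, conj a]` in `SU(1,1)` is `!![conj a, −b; −conj b, a]`. -/
theorem su11_mul_inv (a b : ℂ) (h : normSq a - normSq b = 1) :
    su11 a b * su11 (conj a) (-b) = 1 := by
  have h' : (normSq a : ℂ) - (normSq b : ℂ) = 1 := by exact_mod_cast h
  have ha : a * conj a = (normSq a : ℂ) := Complex.mul_conj a
  have hb : b * conj b = (normSq b : ℂ) := Complex.mul_conj b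
  ext i j
  fin_cases i <;> fin_cases j <;>
    simp [su11, Matrix.mul_apply, Fin.sum_univ_two] <;>
    first
    | linear_combination ha - hb + h'
    | linear_combination hb - ha - h'
    | ring1

/-- `su11 (conj a) (−b) * su11 a b = 1`. -/
theorem su11_inv_mul (a b : ℂ) (h : normSq a - normSq b = 1) :
    su11 (conj a) (-b) * su11 a b = 1 := by
  have h' : (normSq a : ℂ) - (normSq b : ℂ) = 1 := by exact_mod_cast h
  have ha : a * conj a = (normSq a : ℂ) := Complex.mul_conj a
  have hb : b * conj b = (normSq b : ℂ) := Complex.mul_conj b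
  ext i j
  fin_cases i <;> fin_cases j <;>
    simp [su11, Matrix.mul_apply, Fin.sum_univ_two] <;>
    first
    | linear_combination ha - hb + h'
    | linear_combination hb - ha - h'
    | ring1

/-- `su11 a b ∈ U(1,1)` with determinant one, for `normSq a − normSq b = 1`. -/
theorem su11_memU11_det_one (a b : ℂ) (h : normSq a - normSq b = 1) :
    T5UnitaryBound.MemU11 (su11 a b) ∧ (su11 a b).det = 1 := by
  refine ⟨?_, ?_⟩
  · unfold T5UnitaryBound.MemU11 T5UnitaryBound.J
    have h' : (normSq a : ℂ) - (normSq b : ℂ) = 1 := by exact_mod_cast h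
    have ha : conj a * a = (normSq a : ℂ) := by rw [mul_comm]; exact Complex.mul_conj a
    have hb : conj b * b = (normSq b : ℂ) := by rw [mul_comm]; exact Complex.mul_conj b
    ext i j
    fin_cases i <;> fin_cases j <;>
      simp [su11, Matrix.mul_apply, Fin.sum_univ_two, Matrix.conjTranspose_apply] <;>
      first
      | linear_combination ha - hb + h'
      | linear_combination hb - ha - h'
      | ring1
  · have h' : (normSq a : ℂ) - (normSq b : ℂ) = 1 := by exact_mod_cast h
    simp only [su11, Matrix.det_fin_two_of, Complex.mul_conj]
    linear_combination h'

/-- The inverse datum is again in `SU(1,1)`. -/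
theorem normSq_conj_sub_normSq_neg (a b : ℂ) (h : normSq a - normSq b = 1) :
    normSq (conj a) - normSq (-b) = 1 := by
  rw [normSq_conj, normSq_neg]; exact h

/-- `g⁻¹ · (g · z) = z` on the disc. -/
theorem mobius_inv_mobius (a b : ℂ) (h : normSq a - normSq b = 1) {z : ℂ} (hz : normSq z < 1) :
    mobius (su11 (conj a) (-b)) (mobius (su11 a b) z) = z := by
  obtain ⟨hg, hd⟩ := su11_memU11_det_one a b h
  obtain ⟨hg', hd'⟩ := su11_memU11_det_one _ _ (normSq_conj_sub_normSq_neg a b h)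
  rw [← mobius_mul_of_memU11_det_one hg' hd' hg hd hz, su11_inv_mul a b h, mobius_one]

/-- `g · (g⁻¹ · w) = w` on the disc. -/
theorem mobius_mobius_inv (a b : ℂ) (h : normSq a - normSq b = 1) {w : ℂ} (hw : normSq w < 1) :
    mobius (su11 a b) (mobius (su11 (conj a) (-b)) w) = w := by
  obtain ⟨hg, hd⟩ := su11_memU11_det_one a b h
  obtain ⟨hg', hd'⟩ := su11_memU11_det_one _ _ (normSq_conj_sub_normSq_neg a b h)
  rw [← mobius_mul_of_memU11_det_one hg hd hg' hd' hw, su11_mul_inv a b h, mobius_one]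

/-- `g · 𝔻 = 𝔻`. -/
theorem mobius_image_ball (a b : ℂ) (h : normSq a - normSq b = 1) :
    mobius (su11 a b) '' Metric.ball (0 : ℂ) 1 = Metric.ball (0 : ℂ) 1 := by
  ext w
  constructor
  · rintro ⟨z, hz, rfl⟩
    rw [mem_ball_iff_normSq] at hz ⊢
    exact normSq_mobius_lt_one h hz
  · intro hw
    rw [mem_ball_iff_normSq] at hw
    refine ⟨mobius (su11 (conj a) (-b)) w, ?_, mobius_mobius_inv a b h hw⟩
    rw [mem_ball_iff_normSq]
    exact normSq_mobius_lt_one (normSq_conj_sub_normSq_neg a b h) hw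

/-- `g` is injective on `𝔻`. -/
theorem mobius_injOn_ball (a b : ℂ) (h : normSq a - normSq b = 1) :
    InjOn (mobius (su11 a b)) (Metric.ball (0 : ℂ) 1) := by
  intro z₁ hz₁ z₂ hz₂ hzz
  rw [mem_ball_iff_normSq] at hz₁ hz₂
  rw [← mobius_inv_mobius a b h hz₁, hzz, mobius_inv_mobius a b h hz₂]

/-- THE POINCARÉ MEASURE IS `SU(1,1)`-INVARIANT: for `g = !![a, b; conj b, conj a]` with
`‖a‖² − ‖b‖² = 1` and every `F : ℂ → E`,
`∫_{𝔻} (1 − ‖z‖²)⁻² • F (g·z) dA(z) = ∫_{𝔻} (1 − ‖z‖²)⁻² • F z dA(z)`. -/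
theorem integral_ball_comp_mobius (a b : ℂ) (h : normSq a - normSq b = 1) (F : ℂ → E) :
    ∫ z in Metric.ball (0 : ℂ) 1, (1 / (1 - normSq z) ^ 2) • F (mobius (su11 a b) z) =
      ∫ z in Metric.ball (0 : ℂ) 1, (1 / (1 - normSq z) ^ 2) • F z := by
  symm
  conv_lhs => rw [← mobius_image_ball a b h]
  rw [integral_image_eq_integral_abs_det_fderiv_smul (s := Metric.ball (0 : ℂ) 1)
    (f := mobius (su11 a b))
    (f' := fun z => (ContinuousLinearMap.toSpanSingleton ℂ
      (1 / (conj b * z + conj a) ^ 2)).restrictScalars ℝ)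
    volume (Metric.isOpen_ball : IsOpen (Metric.ball (0 : ℂ) 1)).measurableSet
    (fun z hz => ((hasDerivAt_mobius_su11 h ((mem_ball_iff_normSq z).mp hz)).hasFDerivAt.restrictScalars
      ℝ).hasFDerivWithinAt)
    (mobius_injOn_ball a b h)]
  refine setIntegral_congr_fun (Metric.isOpen_ball : IsOpen (Metric.ball (0 : ℂ) 1)).measurableSet
    (fun z hz => ?_)
  rw [mem_ball_iff_normSq] at hz
  rw [det_restrictScalars_toSpanSingleton, abs_of_nonneg (normSq_nonneg _), smul_smul]
  congr 1
  have hgz : (1 - normSq (mobius (su11 a b) z)) ≠ 0 := by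
    have := normSq_mobius_lt_one h hz
    linarith
  have := density_invariance h hz
  rw [div_eq_iff (pow_ne_zero 2 hgz)] at this
  rw [this]
  field_simp

/-- The same with `‖z‖ ^ 2` in place of `normSq z`. -/
theorem integral_ball_comp_mobius' (a b : ℂ) (h : normSq a - normSq b = 1) (F : ℂ → E) :
    ∫ z in Metric.ball (0 : ℂ) 1, (1 / (1 - ‖z‖ ^ 2) ^ 2) • F (mobius (su11 a b) z) =
      ∫ z in Metric.ball (0 : ℂ) 1, (1 / (1 - ‖z‖ ^ 2) ^ 2) • F z := by
  simp only [← Complex.normSq_eq_norm_sq]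
  exact integral_ball_comp_mobius a b h F

end Summit.Ventures.HodgeRepro2.T5PoincareInvariance

end
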